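import Mathlib
import HarnessLib.Audit.Tags

/-!
# The norm form of the pair-sum certificate implies its root form (TODO-29 remainder (b2″-b); bus R314/R320)

Honest framing: elementary commutative algebra, PROVED; no curve, no Galois-image determination, no modularity
claim, no new census, nothing numerical, no instrument touched; it says nothing about any census member.
Mathlib-only (checkable independently of the cell's olean lag).
Context.  The rung-23a instrument `res23.py` certifies an irreducible integer sextic `f` (leading coefficient
`lc`) by a monic cubic `S̃ ∈ ℤ[Y]` (roots `lc·sᵢ`, `sᵢ` the pair sums; `S̃ = lc³·S(Y/lc)` for the monic rational
cubic `S` of the `sᵢ`) and the integer divisibility `f ∣ R_inst := Norm_{ℤ[x][Y]/(S̃)}(G)`,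
`G = lc⁶·f(Y/lc − x)`, where the norm is the 3×3 determinant of multiplication by `G` in the basis `1, Y, Y²`
(`norm_cubic`).  The sibling files type the Sylvester-resultant forms (`ResultantCertificate.lean`, p372536;
`ResultantNormalisation.lean`, p372702).  THIS file types the NORM FORM ITSELF: with
`S̃ := (S.map C).scaleRoots (C lc)` and `G := C (C lc) · (F(Y − x)).integralNormalization` (the instrument's
objects coefficientwise, `coeff_instrumentCubic` / `coeff_instrumentSextic` of p372702) and Mathlib's basis-free
`Algebra.norm ℚ[X] : AdjoinRoot S̃ →* ℚ[X]` (`LinearMap.det` of multiplication — equal to the determinant in any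
basis, in particular the instrument's), `F ∣ Algebra.norm ℚ[X] (AdjoinRoot.mk S̃ G)` implies the ROOT FORM: every
root `r` of `F` has a root `y` of `S` with `F(y − r) = 0` (`pairSum_of_dvd_norm`, over any field where `S` splits;
`pairSum_splittingField_of_dvd_norm` over `SplittingField (F * S)`, verbatim the hypothesis `hpair` of
`hasTwoBlocks_of_pairSum`, `PairSumCertificate.lean`).  After this file the only untyped links between the
instrument's printed IRRED certificate and `HasTwoBlocks` / `|Gal| ∣ 48` are the coefficient embedding
`ℤ[x] ⊂ ℚ[x]` and «`S̃` irreducible over `ℚ` ⇔ `S` irreducible» (a linear substitution); the composite at `Sextic`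
level is filed separately once the pending siblings are in the tree (bus R315/R318).  Registered on the cell bus as
R320 (cell «pub-residmod», 2026-08-23; registration after the feasibility probe, before the proposal).

Mechanism.  (`not_isCoprime_map_of_map_norm_eq_zero`)  For `T ∈ R[Y]` monic and `G ∈ R[Y]`, the norm of `G` in
`R[Y]/(T)` is the determinant of the multiplication matrix in the power basis `1, Y, …, Y^{d−1}`
(`AdjoinRoot.powerBasisAux'`, `Algebra.norm_eq_matrix_det`), whose entries are `((G·Y^j) %ₘ T).coeff i`
(`Algebra.leftMulMatrix_eq_repr_mul`, `AdjoinRoot.modByMonicHom_mk`); a ring map `φ : R → E` acts entrywise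
(`RingHom.map_det`, `Polynomial.map_modByMonic`), giving the norm of `G_E` in `E[Y]/(T_E)`
(`Matrix.det_submatrix_equiv_self` for the reindexing).  If that is `0`, `T_E, G_E` cannot be coprime: a Bézout
relation makes `G_E` a unit of `E[Y]/(T_E)` (`AdjoinRoot.mk_self`), of unit — non-zero — norm.
(`pairSum_of_dvd_norm`)  Apply this with `φ = (aeval r).toRingHom : ℚ[x] → E` for a root `r` of `F` (it kills
`F`, hence the norm): `T_E = S_E.scaleRoots lc` (`Polynomial.map_scaleRoots`) splits (`Splits.scaleRoots`), so a
common non-unit divisor (`isCoprime_of_dvd`) has a root `Y₀ = lc·y` with `S(y) = 0` (`roots_scaleRoots`), and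
`G_E(lc·y) = lc·lc⁵·F_E(y − r)` (`integralNormalization_eval₂_leadingCoeff_mul`), so `F(y − r) = 0`.

Main results (all PROVED, axioms `propext`, `Classical.choice`, `Quot.sound` only):
* `not_isCoprime_map_of_map_norm_eq_zero` — the base-change-and-unit core, for any commutative ring `R`;
* `pairSum_of_dvd_norm`, `pairSum_splittingField_of_dvd_norm` — norm form ⇒ root form.
-/

open Polynomial

namespace Summit.Ventures.ResidMod.Conjectures

section NormForm

/-- Core: if the norm of `G` in `R[Y]/(T)` (`T` monic) maps to `0` under a ring map `φ : R → E` to a field, then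
`T` and `G` are not coprime after mapping to `E`.  The norm is computed in the power basis `1, Y, …, Y^(d-1)`
(`Algebra.norm_eq_matrix_det`, entries `((G·Y^j) %ₘ T).coeff i`), mapped entrywise (`RingHom.map_det`,
`Polynomial.map_modByMonic`), and recognised as the norm of `G_E` in `E[Y]/(T_E)`; a coprime pair would make
`G_E` a unit there, of unit (hence non-zero) norm. -/
theorem not_isCoprime_map_of_map_norm_eq_zero {R E : Type*} [CommRing R] [Field E] (φ : R →+* E) {T : R[X]}
    (hT : T.Monic) (G : R[X]) (h : φ (Algebra.norm R (AdjoinRoot.mk T G)) = 0) :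
    ¬ IsCoprime (T.map φ) (G.map φ) := by
  classical
  have hTφ : (T.map φ).Monic := hT.map φ
  set b := AdjoinRoot.powerBasisAux' hT with hb
  set bE := AdjoinRoot.powerBasisAux' hTφ with hbE
  have hdeg : T.natDegree = (T.map φ).natDegree := (hT.natDegree_map φ).symm
  set e : Fin T.natDegree ≃ Fin (T.map φ).natDegree := finCongr hdeg with he
  -- entries of the multiplication matrices
  have hent : ∀ i j : Fin T.natDegree, φ (Algebra.leftMulMatrix b (AdjoinRoot.mk T G) i j) =
      Algebra.leftMulMatrix bE (AdjoinRoot.mk (T.map φ) (G.map φ)) (e i) (e j) := by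
    intro i j
    rw [Algebra.leftMulMatrix_eq_repr_mul, Algebra.leftMulMatrix_eq_repr_mul]
    have hbj : b j = AdjoinRoot.root T ^ (j : ℕ) := by
      rw [hb]; exact (AdjoinRoot.powerBasis' hT).basis_eq_pow j
    have hbEj : bE (e j) = AdjoinRoot.root (T.map φ) ^ (j : ℕ) := by
      have := (AdjoinRoot.powerBasis' hTφ).basis_eq_pow (e j)
      rw [he, finCongr_apply_coe] at this
      rw [hbE, he]; exact this
    have e1 : AdjoinRoot.mk T G * AdjoinRoot.root T ^ (j : ℕ) = AdjoinRoot.mk T (G * X ^ (j : ℕ)) := by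
      rw [map_mul, map_pow, AdjoinRoot.mk_X]
    have e2 : AdjoinRoot.mk (T.map φ) (G.map φ) * AdjoinRoot.root (T.map φ) ^ (j : ℕ)
        = AdjoinRoot.mk (T.map φ) ((G * X ^ (j : ℕ)).map φ) := by
      rw [Polynomial.map_mul, Polynomial.map_pow, map_X, map_mul, map_pow, AdjoinRoot.mk_X]
    rw [hbj, hbEj, e1, e2, hb, hbE, AdjoinRoot.powerBasisAux'_repr_apply_to_fun,
      AdjoinRoot.powerBasisAux'_repr_apply_to_fun, AdjoinRoot.modByMonicHom_mk, AdjoinRoot.modByMonicHom_mk,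
      ← Polynomial.map_modByMonic φ hT, coeff_map]
    simp [he]
  have hmat : φ.mapMatrix (Algebra.leftMulMatrix b (AdjoinRoot.mk T G))
      = (Algebra.leftMulMatrix bE (AdjoinRoot.mk (T.map φ) (G.map φ))).submatrix e e := by
    ext i j
    simp only [RingHom.mapMatrix_apply, Matrix.map_apply, Matrix.submatrix_apply]
    exact hent i j
  rw [Algebra.norm_eq_matrix_det b, RingHom.map_det, hmat, Matrix.det_submatrix_equiv_self,
    ← Algebra.norm_eq_matrix_det bE] at h
  -- a coprime pair would make `G_E` a unit of `E[Y]/(T_E)`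
  rintro ⟨a, c, hac⟩
  have hmk := congrArg (AdjoinRoot.mk (T.map φ)) hac
  rw [map_add, map_mul, map_mul, AdjoinRoot.mk_self, mul_zero, zero_add, map_one] at hmk
  have hunit : IsUnit (AdjoinRoot.mk (T.map φ) (G.map φ)) :=
    ⟨⟨_, AdjoinRoot.mk (T.map φ) c, by rw [mul_comm]; exact hmk, hmk⟩, rfl⟩
  have := hunit.map (Algebra.norm E)
  rw [h] at this
  exact not_isUnit_zero this

/-- **(9) The instrument's NORM form of the pair-sum certificate gives its root form.**  Let `F, S ∈ ℚ[X]` have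
`deg F = 6`, `S` monic and split in the field `E ⊇ ℚ`, `lc := F.leadingCoeff`,
`S̃ := (S.map C).scaleRoots (C lc)` (`= lc³·S(Y/lc)`, monic) and
`G := C (C lc) · (F(Y − x)).integralNormalization`
(`= lc⁶·F(Y/lc − x)`), and suppose `F ∣ Norm_{ℚ[x][Y]/(S̃)}(G)` (`Algebra.norm`, i.e. the determinant of
multiplication by `G` — what `res23.py` computes in the basis `1, Y, Y²`).  Then every root `r ∈ E` of `F` has
a root `y ∈ E` of `S` with `F(y − r) = 0`. -/
theorem pairSum_of_dvd_norm {E : Type*} [Field E] [Algebra ℚ E] {F S : ℚ[X]}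
    (hF6 : F.natDegree = 6) (hSm : S.Monic) (hsplitS : (S.map (algebraMap ℚ E)).Splits)
    (hdvd : F ∣ Algebra.norm ℚ[X] (AdjoinRoot.mk ((S.map (C : ℚ →+* ℚ[X])).scaleRoots (C F.leadingCoeff))
      (C (C F.leadingCoeff) * ((F.map (C : ℚ →+* ℚ[X])).comp (X - C (X : ℚ[X]))).integralNormalization))) :
    ∀ r ∈ F.rootSet E, ∃ y ∈ S.rootSet E, y - r ∈ F.rootSet E := by
  classical
  intro r hr
  have hF0 : F ≠ 0 := by rintro rfl; simp at hF6
  have hS0 : S ≠ 0 := hSm.ne_zero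
  have hlc0 : F.leadingCoeff ≠ 0 := leadingCoeff_ne_zero.mpr hF0
  have hrF : aeval r F = 0 := (mem_rootSet.mp hr).2
  set lc : ℚ := F.leadingCoeff with hlc
  set ev : ℚ[X] →+* E := (aeval r : ℚ[X] →ₐ[ℚ] E).toRingHom with hev
  have hevC : ev.comp C = algebraMap ℚ E := Subsingleton.elim _ _
  have hevC' : ∀ a : ℚ, ev (C a) = algebraMap ℚ E a := fun a => by rw [← hevC]; rfl
  have hevX : ev X = r := by simp [hev]
  have hevF : ev F = 0 := by simp [hev, hrF]
  set T : ℚ[X][X] := (S.map (C : ℚ →+* ℚ[X])).scaleRoots (C lc) with hT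
  set g : ℚ[X][X] := (F.map (C : ℚ →+* ℚ[X])).comp (X - C (X : ℚ[X])) with hg
  set G : ℚ[X][X] := C (C lc) * g.integralNormalization with hG
  have hTm : T.Monic := (monic_scaleRoots_iff _).mpr (hSm.map _)
  -- the norm vanishes at `x = r`
  have hn : ev (Algebra.norm ℚ[X] (AdjoinRoot.mk T G)) = 0 := by
    obtain ⟨c, hc⟩ := hdvd
    rw [hc, map_mul, hevF, zero_mul]
  have hncop := not_isCoprime_map_of_map_norm_eq_zero ev hTm G hn
  -- identify the mapped polynomials
  set SE : E[X] := S.map (algebraMap ℚ E) with hSE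
  set FE : E[X] := F.map (algebraMap ℚ E) with hFE
  have hCinj : Function.Injective (C : ℚ →+* ℚ[X]) := C_injective
  have hmapS : (S.map (C : ℚ →+* ℚ[X])).map ev = SE := by rw [Polynomial.map_map, hevC]
  have hTE : T.map ev = SE.scaleRoots (algebraMap ℚ E lc) := by
    rw [hT, Polynomial.map_scaleRoots _ _ _ (by
      rw [leadingCoeff_map_of_injective hCinj, hevC']
      exact (map_ne_zero (algebraMap ℚ E)).mpr (hSm.leadingCoeff ▸ one_ne_zero)), hmapS, hevC']
  have hgE : g.map ev = FE.comp (X - C r) := by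
    rw [hg, Polynomial.map_comp, Polynomial.map_map, hevC, Polynomial.map_sub, map_X, map_C, hevX]
  have hsub : (X - C (X : ℚ[X])).natDegree = 1 := natDegree_X_sub_C _
  have hgdeg : g.natDegree = 6 := by
    rw [hg, natDegree_comp, natDegree_map_eq_of_injective hCinj, hF6, hsub]
  have hglc : g.leadingCoeff = C lc := by
    rw [hg, leadingCoeff_comp (by rw [hsub]; exact one_ne_zero), leadingCoeff_map_of_injective hCinj,
      leadingCoeff_X_sub_C, one_pow, mul_one]
  -- a common non-unit divisor of `T_E` and `G_E` has a root `Y₀`, a root of both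
  have hSE0 : SE ≠ 0 := (Polynomial.map_ne_zero_iff (algebraMap ℚ E).injective).mpr hS0
  have hlcE : IsUnit (algebraMap ℚ E lc) := ((map_ne_zero (algebraMap ℚ E)).mpr hlc0).isUnit
  have hTE0 : T.map ev ≠ 0 := by rw [hTE]; exact scaleRoots_ne_zero hSE0 _
  have hTEsplit : (T.map ev).Splits := by rw [hTE]; exact (hsplitS).scaleRoots _
  by_contra hno
  refine hncop (isCoprime_of_dvd _ _ (fun h => hTE0 h.1) fun z hz _ hzT hzG => ?_)
  have hzdeg : z.degree ≠ 0 := fun h0 => (mem_nonunits_iff.mp hz) (Polynomial.isUnit_iff_degree_eq_zero.mpr h0)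
  obtain ⟨Y₀, hY₀⟩ := (hTEsplit.of_dvd hTE0 hzT).exists_eval_eq_zero hzdeg
  have hYT : (T.map ev).eval Y₀ = 0 := eval_eq_zero_of_dvd_of_eval_eq_zero hzT hY₀
  have hYG : (G.map ev).eval Y₀ = 0 := eval_eq_zero_of_dvd_of_eval_eq_zero hzG hY₀
  -- `Y₀ = lc • y` with `y` a root of `S`
  have hY₀root : Y₀ ∈ (SE.scaleRoots (algebraMap ℚ E lc)).roots := by
    rw [← hTE]; exact (mem_roots hTE0).mpr hYT
  rw [roots_scaleRoots _ hlcE, Multiset.mem_map] at hY₀root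
  obtain ⟨y, hy, hyY⟩ := hY₀root
  have hyS : aeval y S = 0 := by
    have := (mem_roots hSE0).mp hy
    rwa [IsRoot.def, hSE, eval_map_algebraMap] at this
  -- `G_E(lc • y) = lc · lc⁵ · F_E(y − r)`
  have hYG' : (algebraMap ℚ E lc) * ((algebraMap ℚ E lc) ^ (6 - 1) * (FE.comp (X - C r)).eval y) = 0 := by
    have h1 : (G.map ev).eval Y₀ = ev (C lc) * (g.integralNormalization).eval₂ ev Y₀ := by
      rw [hG, Polynomial.map_mul, Polynomial.map_C, eval_mul, eval_C, eval_map]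
    have h2 : (g.integralNormalization).eval₂ ev (ev g.leadingCoeff * y)
        = ev g.leadingCoeff ^ (g.natDegree - 1) * g.eval₂ ev y :=
      integralNormalization_eval₂_leadingCoeff_mul (by rw [hgdeg]; norm_num) ev y
    rw [hglc, hevC', hyY, hgdeg] at h2
    rw [h1, h2, hevC', ← eval_map, hgE] at hYG
    exact hYG
  have hFy : aeval (y - r) F = 0 := by
    have hne : (algebraMap ℚ E lc) ≠ 0 := (map_ne_zero (algebraMap ℚ E)).mpr hlc0
    have := hYG'
    rw [mul_eq_zero, mul_eq_zero] at this
    rcases this with h | h | h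
    · exact absurd h hne
    · exact absurd h (pow_ne_zero _ hne)
    · rwa [eval_comp, eval_sub, eval_X, eval_C, hFE, eval_map_algebraMap] at h
  exact hno ⟨y, mem_rootSet.mpr ⟨hS0, hyS⟩, mem_rootSet.mpr ⟨hF0, hFy⟩⟩

/-- **(9′) The norm form over the splitting field of `F·S`.**  As (9), over `SplittingField (F * S)` — verbatim
the hypothesis `hpair` of `hasTwoBlocks_of_pairSum` (`PairSumCertificate.lean`) when `F = toRatPoly f`.
[elementary commutative algebra] -/
theorem pairSum_splittingField_of_dvd_norm {F S : ℚ[X]} (hF6 : F.natDegree = 6) (hSm : S.Monic)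
    (hdvd : F ∣ Algebra.norm ℚ[X] (AdjoinRoot.mk ((S.map (C : ℚ →+* ℚ[X])).scaleRoots (C F.leadingCoeff))
      (C (C F.leadingCoeff) * ((F.map (C : ℚ →+* ℚ[X])).comp (X - C (X : ℚ[X]))).integralNormalization))) :
    ∀ r ∈ F.rootSet (F * S).SplittingField, ∃ y ∈ S.rootSet (F * S).SplittingField,
      y - r ∈ F.rootSet (F * S).SplittingField := by
  have hF0 : F ≠ 0 := by rintro rfl; simp at hF6
  have hFS0 : F * S ≠ 0 := mul_ne_zero hF0 hSm.ne_zero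
  -- type ascribed on purpose (instance search picks `DivisionRing.toRatAlgebra` on the splitting field)
  have hsplit : ((F * S).map (algebraMap ℚ (F * S).SplittingField)).Splits := SplittingField.splits (F * S)
  have hne : (F * S).map (algebraMap ℚ (F * S).SplittingField) ≠ 0 :=
    (Polynomial.map_ne_zero_iff (algebraMap ℚ _).injective).mpr hFS0
  exact pairSum_of_dvd_norm hF6 hSm (hsplit.of_dvd hne (Polynomial.map_dvd _ (dvd_mul_left _ _))) hdvd

end NormForm

end Summit.Ventures.ResidMod.Conjectures
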